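import Mathlib
import HarnessLib
import Summits.AnomalousDissipation.AnomalousDissipation.Theses.MomentParity
import Literature.Analysis.FluidPDE.StatisticalSolution
import Literature.Analysis.FluidPDE.NSGalerkinTrajectory
import Literature.Analysis.FunctionSpaces.TorusTrigPoly

/-!
# Sketch — crux-ideate stmt-AnomalousDissipation-11463 (MomentParity.MomentLadder), round 1, ideator 2

First lemmas and Galerkin-level transfers for two idea cards:

* `ecs-persistence-orbital-measures` — `OrbitalMeasureStationary`, `GalerkinPeriodicTower`,
  `OrbitalWitness`, glue `momentLadder_of_tower`;
* `flux-tail-enstrophy-moment` — `FluxTailIdentity`, `FluxTrilinearBound`,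
  `EnstrophyMomentResolution`, `GalerkinInvariantLoudMoment`, glue `momentLadder_of_moment`.

Nothing here is proposed to the tree; the two glue theorems are kernel-checked pure logic showing
that each line concludes `MomentParity.MomentLadder` BY NAME.
-/

namespace Summit.AnomalousDissipation.AnomalousDissipation.Cruxes.MomentLadder.Ideate2

open MeasureTheory Filter Set
open scoped ENNReal

local notation "𝕋³" => UnitAddTorus (Fin 3)
local notation "E³" => EuclideanSpace ℝ (Fin 3)
local notation "H³" => Literature.Analysis.FunctionSpaces.Torus.energySpace (Fin 3)

/-! ## The body of `MomentLadder` (verbatim), factored -/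

/-- The clauses of `MomentParity.MomentLadder` after `∃ μ`, verbatim, as a predicate of
`(ν, f, N, R, κ, E, ε, d, μ)`. -/
def LadderBody (ν : ℝ) (f : 𝕋³ → E³) (N : ℕ) (R : ℝ) (κ : ℕ → ℕ) (E ε : ℝ) (d : ℕ)
    (μ : Measure H³) : Prop :=
  MeasureTheory.IsProbabilityMeasure μ ∧ (∀ᵐ (u : Literature.Analysis.FunctionSpaces.Torus.energySpace (Fin 3)) ∂μ, (∀ k ∉ (Literature.Analysis.FunctionSpaces.Torus.freqBall N).erase (0 : Fin 3 → ℤ), UnitAddTorus.mFourierCoeff (Literature.Analysis.FunctionSpaces.EuclideanSpace.complexify ∘ (u.1 : UnitAddTorus (Fin 3) → EuclideanSpace ℝ (Fin 3))) k = 0)) ∧ (∀ᵐ u ∂μ, ‖u‖ ≤ R) ∧ (∀ n : ℕ, ∫⁻ (u : Literature.Analysis.FunctionSpaces.Torus.energySpace (Fin 3)), Literature.Analysis.FunctionSpaces.Torus.eGradNormSq (u.1 : UnitAddTorus (Fin 3) → EuclideanSpace ℝ (Fin 3)) ∂μ ≤ (∫⁻ (u : Literature.Analysis.FunctionSpaces.Torus.energySpace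 (Fin 3)), Literature.Analysis.FunctionSpaces.Torus.eGradNormSq (Literature.Analysis.FunctionSpaces.Torus.fourierTruncate (κ n) (u.1 : UnitAddTorus (Fin 3) → EuclideanSpace ℝ (Fin 3))) ∂μ) + ((n : ENNReal) + 1)⁻¹) ∧ (∀ (m : ℕ) (g : Fin m → UnitAddTorus (Fin 3) → EuclideanSpace ℝ (Fin 3)) (P : MvPolynomial (Fin m) ℝ), (∀ i, (Literature.Analysis.FunctionSpaces.Torus.IsSmooth (g i) ∧ Literature.Analysis.FunctionSpaces.Torus.IsDivFree (g i) ∧ Literature.Analysis.FunctionSpaces.Torus.HasZeroMean (g i) ∧ (∀ k ∉ (Literature.Analysis.FunctionSpaces.Torus.freqBall N).erase (0 : Fin 3 → ℤ), UnitAddTorus.mFourierCoeff (Literature.Analysis.FunctionSpaces.EuclideanSpace.complexify ∘ (g i)) k = 0))) → P.totalDegree + 1 ≤ d → MeasureTheory.Integrable (fun u => Literature.Analysis.FluidPDE.Torus.nsGeneratorPairing ν f u (fun x => ∑ i : Fin m, (MvPolynomial.eval (fun j => Literature.Analysis.FluidPDE.Torus.pairing u.1 (g j)) (MvPolynomial.pderiv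 i P)) • g i x)) μ ∧ ∫ u, Literature.Analysis.FluidPDE.Torus.nsGeneratorPairing ν f u (fun x => ∑ i : Fin m, (MvPolynomial.eval (fun j => Literature.Analysis.FluidPDE.Torus.pairing u.1 (g j)) (MvPolynomial.pderiv i P)) • g i x) ∂μ = 0) ∧ Literature.Analysis.FluidPDE.Torus.ensembleEnergy μ ≤ E ∧ ε ≤ Literature.Analysis.FluidPDE.Torus.ensembleDissipation ν μ

/-- `MomentLadder` is literally `∃ f … ∀ j ∃ R κ ∃ᶠ N ∀ d ∃ μ, LadderBody …` (definitional). -/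
theorem momentLadder_iff :
    Summit.AnomalousDissipation.AnomalousDissipation.Theses.MomentParity.MomentLadder ↔
      ∃ f : 𝕋³ → E³, Literature.Analysis.FunctionSpaces.Torus.IsSmooth f ∧
        Literature.Analysis.FunctionSpaces.Torus.IsDivFree f ∧
        Literature.Analysis.FunctionSpaces.Torus.HasZeroMean f ∧
        ∃ (ν : ℕ → ℝ) (E ε : ℝ), (∀ j, 0 < ν j) ∧ Tendsto ν atTop (nhds 0) ∧ 0 < ε ∧
          ∀ j : ℕ, ∃ (R : ℝ) (κ : ℕ → ℕ), ∃ᶠ N in atTop, ∀ d : ℕ, ∃ μ : Measure H³,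
            LadderBody (ν j) f N R κ E ε d μ :=
  Iff.rfl

/-! ## Shared vocabulary -/

/-- `u` is carried by the level-`N` Fourier–Galerkin modes (`û(k) = 0` off `0 < |k| ≤ N`),
verbatim the route's clause. -/
def IsLevel (N : ℕ) (u : 𝕋³ → E³) : Prop :=
  ∀ k ∉ (Literature.Analysis.FunctionSpaces.Torus.freqBall N).erase (0 : Fin 3 → ℤ),
    UnitAddTorus.mFourierCoeff (Literature.Analysis.FunctionSpaces.EuclideanSpace.complexify ∘ u) k = 0

/-- Stationarity against ALL polynomial cylindrical tests with level-`N` smooth solenoidal fields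
(the rows of `MomentLadder` without the degree restriction = Galerkin invariance on compactly
supported level-`N` laws, cf. `MomentClosure`). -/
def IsPolyStationary (ν : ℝ) (f : 𝕋³ → E³) (N : ℕ) (μ : Measure H³) : Prop :=
  ∀ (m : ℕ) (g : Fin m → 𝕋³ → E³) (P : MvPolynomial (Fin m) ℝ),
    (∀ i, (Literature.Analysis.FunctionSpaces.Torus.IsSmooth (g i) ∧
      Literature.Analysis.FunctionSpaces.Torus.IsDivFree (g i) ∧
      Literature.Analysis.FunctionSpaces.Torus.HasZeroMean (g i) ∧
      (∀ k ∉ (Literature.Analysis.FunctionSpaces.Torus.freqBall N).erase (0 : Fin 3 → ℤ),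
        UnitAddTorus.mFourierCoeff (Literature.Analysis.FunctionSpaces.EuclideanSpace.complexify ∘ (g i)) k = 0))) →
    MeasureTheory.Integrable (fun u => Literature.Analysis.FluidPDE.Torus.nsGeneratorPairing ν f u
      (fun x => ∑ i : Fin m, (MvPolynomial.eval (fun j => Literature.Analysis.FluidPDE.Torus.pairing u.1 (g j))
        (MvPolynomial.pderiv i P)) • g i x)) μ ∧
    ∫ u, Literature.Analysis.FluidPDE.Torus.nsGeneratorPairing ν f u
      (fun x => ∑ i : Fin m, (MvPolynomial.eval (fun j => Literature.Analysis.FluidPDE.Torus.pairing u.1 (g j))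
        (MvPolynomial.pderiv i P)) • g i x) ∂μ = 0

/-- The `κ`-resolution clause of `MomentLadder` for one measure. -/
def IsResolved (κ : ℕ → ℕ) (μ : Measure H³) : Prop :=
  ∀ n : ℕ, ∫⁻ (u : H³), Literature.Analysis.FunctionSpaces.Torus.eGradNormSq (u.1 : 𝕋³ → E³) ∂μ ≤
    (∫⁻ (u : H³), Literature.Analysis.FunctionSpaces.Torus.eGradNormSq
      (Literature.Analysis.FunctionSpaces.Torus.fourierTruncate (κ n) (u.1 : 𝕋³ → E³)) ∂μ) + ((n : ENNReal) + 1)⁻¹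

/-- Packaging: a loud, level-`N`, `B_R`-supported, `κ`-resolved, poly-stationary law gives the
ladder body at every degree `d` (the degree hypothesis is simply dropped). Pure logic. -/
theorem ladderBody_of_stationary {ν : ℝ} {f : 𝕋³ → E³} {N : ℕ} {R : ℝ} {κ : ℕ → ℕ} {E ε : ℝ}
    {μ : Measure H³} (hP : IsProbabilityMeasure μ) (hL : ∀ᵐ u ∂μ, IsLevel N (u.1 : 𝕋³ → E³))
    (hR : ∀ᵐ u ∂μ, ‖u‖ ≤ R) (hκ : IsResolved κ μ) (hS : IsPolyStationary ν f N μ)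
    (hE : Literature.Analysis.FluidPDE.Torus.ensembleEnergy μ ≤ E)
    (hε : ε ≤ Literature.Analysis.FluidPDE.Torus.ensembleDissipation ν μ) (d : ℕ) :
    LadderBody ν f N R κ E ε d μ :=
  ⟨hP, hL, hR, hκ, fun m g P hg _ => hS m g P hg, hE, hε⟩

/-! ## Card `flux-tail-enstrophy-moment` -/

/-- FIRST LEMMA (flux–tail identity; FMRT 2001 Ch. V Thm 5.1 (5.27) / App. B.4, which is an
INEQUALITY for 3-D time-average measures, made an EQUALITY at the Galerkin level): for a
`B_R`-supported level-`N` poly-stationary law and `K ≤ N`, the dissipation carried above `K` equals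
the mean spectral energy flux through `K` plus the direct injection above `K`:
`ν(∫‖∇u‖² − ∫‖∇P_K u‖²) = ∫ (f, Q_K u) dμ − ∫ inertialPairing(u, P_K u) dμ`
(`inertialPairing u w = b(u,w,u) = −b(u,u,w)`; the two rows used are the degree-2 tests
`½|P_K u|²` and `½|P_N u|²`). -/
def FluxTailIdentity : Prop :=
  ∀ (ν : ℝ) (f : 𝕋³ → E³) (N K : ℕ) (R : ℝ) (μ : Measure H³),
    0 < ν → Literature.Analysis.FunctionSpaces.Torus.IsSmooth f → K ≤ N → IsProbabilityMeasure μ →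
    (∀ᵐ u ∂μ, IsLevel N (u.1 : 𝕋³ → E³)) → (∀ᵐ u ∂μ, ‖u‖ ≤ R) → IsPolyStationary ν f N μ →
    ν * ((∫⁻ u, Literature.Analysis.FunctionSpaces.Torus.eGradNormSq (u.1 : 𝕋³ → E³) ∂μ).toReal -
        (∫⁻ u, Literature.Analysis.FunctionSpaces.Torus.eGradNormSq
          (Literature.Analysis.FunctionSpaces.Torus.fourierTruncate K (u.1 : 𝕋³ → E³)) ∂μ).toReal) =
      (∫ u, (Literature.Analysis.FluidPDE.Torus.pairing u.1 f -
          Literature.Analysis.FluidPDE.Torus.pairing u.1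
            (Literature.Analysis.FunctionSpaces.Torus.fourierTruncate K f)) ∂μ) -
        ∫ u, Literature.Analysis.FluidPDE.Torus.inertialPairing u.1
          (Literature.Analysis.FunctionSpaces.Torus.fourierTruncate K (u.1 : 𝕋³ → E³)) ∂μ

/-- FIRST LEMMA, quantitative half (the trilinear flux bound, CET/CCFS-type, spectral form):
`|b(u, P_K u, Q_K u)| ≤ C |u|^{3−q} K^{−(q−5/2)} ‖∇u‖^{q}` for `5/2 ≤ q ≤ 3`
(interpolating `‖u‖₆‖∇P_Ku‖₂‖Q_Ku‖₃ ≤ C K^{-1/2}‖∇u‖³` and `‖u‖₃‖∇P_Ku‖₂‖Q_Ku‖₆ ≤ C|u|^{1/2}‖∇u‖^{5/2}`;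
Sobolev `H¹ ⊂ L⁶`, `‖v‖₃² ≤ ‖v‖₂‖v‖₆`, Poincaré `|Q_K v| ≤ (2πK)⁻¹‖∇Q_K v‖` on `T³`). -/
def FluxTrilinearBound : Prop :=
  ∃ C : ℝ, ∀ (K : ℕ) (q : ℝ) (u : H³), 1 ≤ K → 5 / 2 ≤ q → q ≤ 3 →
    Literature.Analysis.FunctionSpaces.Torus.eGradNormSq (u.1 : 𝕋³ → E³) < ⊤ →
    |Literature.Analysis.FluidPDE.Torus.inertialPairing u.1
        (Literature.Analysis.FunctionSpaces.Torus.fourierTruncate K (u.1 : 𝕋³ → E³))| ≤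
      C * ‖u‖ ^ (3 - q) * (K : ℝ) ^ (-(q - 5 / 2)) *
        ((Literature.Analysis.FunctionSpaces.Torus.eGradNormSq (u.1 : 𝕋³ → E³)).toReal) ^ (q / 2)

/-- STUB-SIZED CONSEQUENCE (provable from the two lemmas + `|Q_K f| → 0`): at fixed `(f, ν, R)` an
`N`-uniform bound on ONE scalar moment `∫ ‖∇u‖₂^q dμ ≤ M` with `q > 5/2` yields ONE resolution
schedule `κ` serving every level `N` and every such invariant law — `ResolvedDissipation`
restricted to the moment class, with the explicit rate `tail(K) ≲ R^{3−q}K^{−(q−5/2)}M/ν + R|Q_K f|/ν`. -/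
def EnstrophyMomentResolution : Prop :=
  ∀ f : 𝕋³ → E³, Literature.Analysis.FunctionSpaces.Torus.IsSmooth f →
    Literature.Analysis.FunctionSpaces.Torus.IsDivFree f → Literature.Analysis.FunctionSpaces.Torus.HasZeroMean f →
    ∀ (ν R M q : ℝ), 0 < ν → 5 / 2 < q →
    ∃ κ : ℕ → ℕ, ∀ (N : ℕ) (μ : Measure H³), IsProbabilityMeasure μ →
      (∀ᵐ u ∂μ, IsLevel N (u.1 : 𝕋³ → E³)) → (∀ᵐ u ∂μ, ‖u‖ ≤ R) → IsPolyStationary ν f N μ →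
      (∫ u, ((Literature.Analysis.FunctionSpaces.Torus.eGradNormSq (u.1 : 𝕋³ → E³)).toReal) ^ (q / 2) ∂μ) ≤ M →
      IsResolved κ μ

/-- TRANSFER `C⁺` of the card: `GalerkinInvariantLoud` whose witnesses carry an `N`-uniform
`q`-moment of the enstrophy norm, `q > 5/2` (physically `M_j ≈ (ε/ν_j)^{q/2}`: the volume-averaged
enstrophy of resolved turbulence at fixed `ν` is self-averaging). -/
def GalerkinInvariantLoudMoment : Prop :=
  ∃ f : 𝕋³ → E³, Literature.Analysis.FunctionSpaces.Torus.IsSmooth f ∧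
    Literature.Analysis.FunctionSpaces.Torus.IsDivFree f ∧ Literature.Analysis.FunctionSpaces.Torus.HasZeroMean f ∧
    ∃ (ν : ℕ → ℝ) (E ε q : ℝ), (∀ j, 0 < ν j) ∧ Tendsto ν atTop (nhds 0) ∧ 0 < ε ∧ 5 / 2 < q ∧
      ∀ j : ℕ, ∃ R M : ℝ, ∃ᶠ N in atTop, ∃ μ : Measure H³, IsProbabilityMeasure μ ∧
        (∀ᵐ u ∂μ, IsLevel N (u.1 : 𝕋³ → E³)) ∧ (∀ᵐ u ∂μ, ‖u‖ ≤ R) ∧ IsPolyStationary (ν j) f N μ ∧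
        (∫ u, ((Literature.Analysis.FunctionSpaces.Torus.eGradNormSq (u.1 : 𝕋³ → E³)).toReal) ^ (q / 2) ∂μ) ≤ M ∧
        Literature.Analysis.FluidPDE.Torus.ensembleEnergy μ ≤ E ∧
        ε ≤ Literature.Analysis.FluidPDE.Torus.ensembleDissipation (ν j) μ

/-- GLUE of the line (kernel-checked): `C⁺ →` (moment resolution) `→ MomentLadder`, by name. -/
theorem momentLadder_of_moment (hX : GalerkinInvariantLoudMoment) (hRes : EnstrophyMomentResolution) :
    Summit.AnomalousDissipation.AnomalousDissipation.Theses.MomentParity.MomentLadder := by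
  rw [momentLadder_iff]
  obtain ⟨f, hfs, hfd, hfz, ν, E, ε, q, hν, hν0, hε, hq, hj⟩ := hX
  refine ⟨f, hfs, hfd, hfz, ν, E, ε, hν, hν0, hε, fun j => ?_⟩
  obtain ⟨R, M, hfreq⟩ := hj j
  obtain ⟨κ, hκ⟩ := hRes f hfs hfd hfz (ν j) R M q (hν j) hq
  refine ⟨R, κ, hfreq.mono fun N hN d => ?_⟩
  obtain ⟨μ, hP, hL, hR, hS, hM, hE, hεμ⟩ := hN
  exact ⟨μ, ladderBody_of_stationary hP hL hR (hκ N μ hP hL hR hS hM) hS hE hεμ d⟩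

/-! ## Card `ecs-persistence-orbital-measures` -/

/-- The orbital (occupation) measure of a `T`-periodic path `Γ : ℝ → H`:
`μ_Γ = T⁻¹ ∫₀ᵀ δ_{Γ(t)} dt`. -/
noncomputable def orbitalMeasure (T : ℝ) (Γ : ℝ → H³) : Measure H³ :=
  (ENNReal.ofReal T)⁻¹ • (volume.restrict (Set.Ioc (0 : ℝ) T)).map Γ

/-- FIRST LEMMA (orbital measures of periodic Galerkin trajectories are Galerkin-invariant laws):
if `U` is a global level-`N` Galerkin trajectory (`Torus.IsGalerkinTrajectory`) with period
`T > 0` and `Γ` is a measurable version of `t ↦ [U t] ∈ H`, then `μ_Γ` satisfies every polynomial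
row (all degrees): `∫ ⟨F(u), ∇p(u)⟩ dμ_Γ = T⁻¹ (p(U T) − p(U 0)) = 0` by the tested Galerkin
equations and the chain rule. Steady states are the case `U` constant. -/
def OrbitalMeasureStationary : Prop :=
  ∀ (ν : ℝ) (f : 𝕋³ → E³) (N : ℕ) (U : ℝ → 𝕋³ → E³) (Γ : ℝ → H³) (T : ℝ),
    0 < ν → Literature.Analysis.FunctionSpaces.Torus.IsSmooth f → 0 < T →
    Literature.Analysis.FluidPDE.Torus.IsGalerkinTrajectory ν f N U →
    (∀ t, 0 ≤ t → U (t + T) = U t) →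
    Measurable Γ → (∀ t, 0 ≤ t → ((Γ t).1 : 𝕋³ → E³) =ᵐ[volume] U t) →
    IsPolyStationary ν f N (orbitalMeasure T Γ)

/-- TRANSFER at the Galerkin level (what persistence of hyperbolic exact coherent structures of
`NS_ν` delivers): a tower of loud, bounded, `N`-uniformly resolved PERIODIC Galerkin trajectories —
for every `j`, one radius `R_j`, one schedule `κ_j`, and for infinitely many `N` a level-`N`
`T`-periodic Galerkin solution with pointwise energy `≤ R²`, period-mean energy `≤ E`, period-mean
dissipation `≥ ε`, and `κ_j`-resolved period-mean enstrophy. -/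
def GalerkinPeriodicTower : Prop :=
  ∃ f : 𝕋³ → E³, Literature.Analysis.FunctionSpaces.Torus.IsSmooth f ∧
    Literature.Analysis.FunctionSpaces.Torus.IsDivFree f ∧ Literature.Analysis.FunctionSpaces.Torus.HasZeroMean f ∧
    ∃ (ν : ℕ → ℝ) (E ε : ℝ), (∀ j, 0 < ν j) ∧ Tendsto ν atTop (nhds 0) ∧ 0 < ε ∧
      ∀ j : ℕ, ∃ (R : ℝ) (κ : ℕ → ℕ), ∃ᶠ N in atTop, ∃ (U : ℝ → 𝕋³ → E³) (T : ℝ), 0 < T ∧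
        Literature.Analysis.FluidPDE.Torus.IsGalerkinTrajectory (ν j) f N U ∧
        (∀ t, 0 ≤ t → U (t + T) = U t) ∧
        (∀ t, 0 ≤ t → ∫ x, ‖U t x‖ ^ 2 ≤ R ^ 2) ∧
        T⁻¹ * (∫ t in (0 : ℝ)..T, ∫ x, ‖U t x‖ ^ 2) ≤ E ∧
        ε ≤ ν j * (T⁻¹ * ∫ t in (0 : ℝ)..T,
          (Literature.Analysis.FunctionSpaces.Torus.eGradNormSq (U t)).toReal) ∧
        (∀ n : ℕ, (∫ t in (0 : ℝ)..T, (Literature.Analysis.FunctionSpaces.Torus.eGradNormSq (U t)).toReal) ≤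
          (∫ t in (0 : ℝ)..T, (Literature.Analysis.FunctionSpaces.Torus.eGradNormSq
            (Literature.Analysis.FunctionSpaces.Torus.fourierTruncate (κ n) (U t))).toReal) + T / ((n : ℝ) + 1))

/-- PACKAGING STUB (measure theory, provable now; contains `OrbitalMeasureStationary`): the orbital
measure of such a periodic Galerkin trajectory satisfies the whole ladder body at every degree. -/
def OrbitalWitness : Prop :=
  ∀ (ν : ℝ) (f : 𝕋³ → E³) (N : ℕ) (R : ℝ) (κ : ℕ → ℕ) (E ε : ℝ) (U : ℝ → 𝕋³ → E³) (T : ℝ),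
    0 < ν → Literature.Analysis.FunctionSpaces.Torus.IsSmooth f →
    Literature.Analysis.FunctionSpaces.Torus.IsDivFree f → Literature.Analysis.FunctionSpaces.Torus.HasZeroMean f →
    0 < T → Literature.Analysis.FluidPDE.Torus.IsGalerkinTrajectory ν f N U →
    (∀ t, 0 ≤ t → U (t + T) = U t) →
    (∀ t, 0 ≤ t → ∫ x, ‖U t x‖ ^ 2 ≤ R ^ 2) →
    T⁻¹ * (∫ t in (0 : ℝ)..T, ∫ x, ‖U t x‖ ^ 2) ≤ E →
    ε ≤ ν * (T⁻¹ * ∫ t in (0 : ℝ)..T, (Literature.Analysis.FunctionSpaces.Torus.eGradNormSq (U t)).toReal) →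
    (∀ n : ℕ, (∫ t in (0 : ℝ)..T, (Literature.Analysis.FunctionSpaces.Torus.eGradNormSq (U t)).toReal) ≤
      (∫ t in (0 : ℝ)..T, (Literature.Analysis.FunctionSpaces.Torus.eGradNormSq
        (Literature.Analysis.FunctionSpaces.Torus.fourierTruncate (κ n) (U t))).toReal) + T / ((n : ℝ) + 1)) →
    ∃ μ : Measure H³, ∀ d : ℕ, LadderBody ν f N R κ E ε d μ

/-- GLUE of the line (kernel-checked): tower `→` packaging `→ MomentLadder`, by name. -/
theorem momentLadder_of_tower (hX : GalerkinPeriodicTower) (hW : OrbitalWitness) :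
    Summit.AnomalousDissipation.AnomalousDissipation.Theses.MomentParity.MomentLadder := by
  rw [momentLadder_iff]
  obtain ⟨f, hfs, hfd, hfz, ν, E, ε, hν, hν0, hε, hj⟩ := hX
  refine ⟨f, hfs, hfd, hfz, ν, E, ε, hν, hν0, hε, fun j => ?_⟩
  obtain ⟨R, κ, hfreq⟩ := hj j
  refine ⟨R, κ, hfreq.mono fun N hN d => ?_⟩
  obtain ⟨U, T, hT, hU, hper, hRU, hEU, hεU, hκU⟩ := hN
  obtain ⟨μ, hμ⟩ := hW (ν j) f N R κ E ε U T (hν j) hfs hfd hfz hT hU hper hRU hEU hεU hκU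
  exact ⟨μ, hμ d⟩

end Summit.AnomalousDissipation.AnomalousDissipation.Cruxes.MomentLadder.Ideate2
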